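import Summits.NavierStokesRegularity.NavierStokesRegularity.Theorems.SelfMixingDichotomyCoherentScaleExclusionKinWitness
import Summits.NavierStokesRegularity.NavierStokesRegularity.Theorems.SelfMixingDichotomyCoherentScaleExclusionUnboundedLoad

set_option linter.dupNamespace false

/-!
# Route SelfMixingDichotomy — crux `CoherentScaleExclusion` (S2, stmt-NavierStokesRegularity-1423):
# the crux itself is not a kinematic fact

`--supports stmt-NavierStokesRegularity-1423`, line lead c2. Corollary of the kinematic witness
(`coherentCascade_kinematicWitness`, file `…KinWitness`): not only the cascade stub B but the CRUX S2 in its own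
shape — "for every `δ > 0` there is `M` such that recurrent `M`-loaded non-`δ`-mixing scales at a final-time point
force local boundedness" — is false once the Navier–Stokes class (`IsClassicalNSSolutionOn ∧ IsLerayHopfOn ∧
HasRapidSpatialDecay (u 0)`) is replaced by the kinematic class (smooth space–time field on `[0,T) × ℝ³`,
divergence free, uniformly bounded finite energy, `L∞` Type-I(2)). The logic is that of
`cascadeRegime_of_coherentScaleExclusion` (S2 ⇒ B), whose only analytic input, the load ceiling under boundedness
(`coherentScaleExclusion_loadCeiling_of_bdd`), is class-independent.
-/

noncomputable section

open Literature.Analysis.FluidPDE MeasureTheory Set Function Metric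

namespace Summit.NavierStokesRegularity.NavierStokesRegularity.Theorems

/-- **The crux S2 is false without the momentum equation** (registered sub-goal). With the Navier–Stokes class of
`CoherentScaleExclusion` replaced by the kinematic class — `IsSmoothSpaceTimeOn (Ico 0 T) u`, divergence free on
`[0,T)`, uniformly bounded finite energy on `[0,T)`, and the `L∞` Type-I bound `√(T−t)‖u‖ ≤ 2` on `[0,T)` — the
statement "∀ δ > 0 ∃ M: recurrent `M`-loaded non-`δ`-mixing scales at `(T,x₀)` ⇒ `u` bounded near `(T,x₀)`"
fails: for the swirling core of `coherentCascade_kinematicWitness` (`T = 1`, `x₀ = 0`) every small scale is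
`M`-loaded (the load diverges) and non-`δ`-mixing, while boundedness near `(1,0)` would cap the load
(`coherentScaleExclusion_loadCeiling_of_bdd`), contradicting its divergence. So no argument that uses only
incompressibility, the energy class, the Type-I rate and smoothness before `T` can prove the crux. -/
theorem coherentScaleExclusion_false_without_momentum :
    ¬ (∀ δ : ℝ, 0 < δ → ∃ M : ℝ, ∀ T : ℝ, 0 < T →
      ∀ (u : ℝ → EuclideanSpace ℝ (Fin 3) → EuclideanSpace ℝ (Fin 3)),
      Literature.Analysis.FluidPDE.IsSmoothSpaceTimeOn (Set.Ico 0 T) u →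
      (∀ t ∈ Set.Ico 0 T, Literature.Analysis.FluidPDE.VectorCalculus.IsDivFree (u t)) →
      (∃ E₀ : ℝ, ∀ t ∈ Set.Ico 0 T, MeasureTheory.MemLp (u t) 2 MeasureTheory.volume ∧ ∫ x, ‖u t x‖ ^ 2 ≤ E₀) →
      (∀ t ∈ Set.Ico 0 T, ∀ x : EuclideanSpace ℝ (Fin 3), Real.sqrt (T - t) * ‖u t x‖ ≤ 2) →
      ∀ x₀ : EuclideanSpace ℝ (Fin 3),
      (∀ r₀ : ℝ, 0 < r₀ → ∃ r ∈ Set.Ioo 0 r₀,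
          ENNReal.ofReal M ≤ Literature.Analysis.FluidPDE.cknC r ((T, x₀) : ℝ × EuclideanSpace ℝ (Fin 3)) u ∧
          ¬ Literature.Analysis.FluidPDE.DissipatesAtScale u T x₀ r δ) →
      ∃ ρ : ℝ, 0 < ρ ∧ ∃ M : ℝ, ∀ t ∈ Set.Ioo (T - ρ ^ 2) T, ∀ x ∈ Metric.ball x₀ ρ, ‖u t x‖ ≤ M) := by
  intro h
  obtain ⟨δ, hδ, -, u, hsm, hdiv, hE, hTI, hcasc, ⟨r₂, hr₂, hmix⟩, -⟩ := coherentCascade_kinematicWitness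
  obtain ⟨M, hM⟩ := h δ hδ
  obtain ⟨E₀, hE₀⟩ := hE
  -- every small scale at `(1,0)` is `M`-loaded and non-`δ`-mixing
  obtain ⟨r₁, hr₁, hload⟩ := hcasc M
  have hrec : ∀ r₀ : ℝ, 0 < r₀ → ∃ r ∈ Set.Ioo 0 r₀,
      ENNReal.ofReal M ≤ cknC r (((1 : ℝ), (0 : EuclideanSpace ℝ (Fin 3))) : ℝ × EuclideanSpace ℝ (Fin 3)) u ∧
      ¬ DissipatesAtScale u 1 0 r δ := by
    intro r₀ hr₀
    have hm : 0 < min r₀ (min r₁ r₂) := lt_min hr₀ (lt_min hr₁ hr₂)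
    refine ⟨min r₀ (min r₁ r₂) / 2, ⟨by positivity, by linarith [min_le_left r₀ (min r₁ r₂)]⟩, ?_, ?_⟩
    · exact hload _ ⟨by positivity,
        by linarith [min_le_right r₀ (min r₁ r₂), min_le_left r₁ r₂]⟩
    · exact hmix _ ⟨by positivity,
        by linarith [min_le_right r₀ (min r₁ r₂), min_le_right r₁ r₂]⟩
  -- the kinematic "crux" gives boundedness near `(1,0)`, which caps the load; the load diverges
  have hbdd := hM 1 one_pos u hsm (fun t _ => hdiv t) ⟨E₀, fun t ht => hE₀ t ht.1⟩
    (fun t ht x => hTI t ht.2 x) 0 hrec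
  exact coherentScaleExclusion_not_loadCeiling_of_unboundedLoad
    (coherentScaleExclusion_unboundedLoad_of_cascade hcasc) (coherentScaleExclusion_loadCeiling_of_bdd hbdd)

end Summit.NavierStokesRegularity.NavierStokesRegularity.Theorems

end
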